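import Summits.CriticalPhenomena.PercolationContinuityZ3.Theorems.PercNearOneGluingNoHeavyPcintNawFreeZ4F12Defs
import HarnessLib

/-!
# PCINT lane, kernel reduced-state B2d (`nawfree`) certificate `Z4F12` (d = 4, memory τ = 12, delay kt = 4, 12932 state classes): row checks 19 (rows [5400, 5700))

Cell `prim-pcint`, seat `prim-pcint-1` (gen 7); memo `run/shared/lean/prim/pcint/REDUCTIONS.md` §B2d (delayed chain payments with
free-neighbour shares).  Does NOT build on p205010.  Data for `NawK.le_siteCriticalProb_of_checkRowsF` (`…PcintNawFreeMemKernelCert`):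
`p = 17090/100000`, weight table `Q_k/100000`, `Q = [82910, 82910, 91055, 93944, 95423, 96322, 96925, 97359, 97685]` (`Q_k^k·100000 ≥ (100000-17090)·100000^k`, nondecreasing), `λ = 99999/100000`; Collatz–Wielandt
weights (scale 10⁹) from a power iteration, exact off-line max row ratio 0.9994858418 < λ.  Generated by work/gen6/gen_free.py
(pcint-1 gen 6; run by gen 7); the kernel re-checks every row.
-/

namespace Summit.CriticalPhenomena.PercolationContinuityZ3.Theorems.Pcint.NawFreeZ4F12

set_option maxHeartbeats 0 in
/-- Rows `[5400, 5450)` pass the check. [folklore] -/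
theorem chk_5400 : WinK.allRange (NawK.checkRowF 12 4 4 12932 17090 100000 99999 100000 NawFreeZ4F12.QL NawFreeZ4F12.syms NawFreeZ4F12.tree) 5400 5450 = true :=
  WinK.allRange_of_allRangeB (fuel := 8) (lo := 5400) (len := 50) (by decide +kernel)

set_option maxHeartbeats 0 in
/-- Rows `[5450, 5500)` pass the check. [folklore] -/
theorem chk_5450 : WinK.allRange (NawK.checkRowF 12 4 4 12932 17090 100000 99999 100000 NawFreeZ4F12.QL NawFreeZ4F12.syms NawFreeZ4F12.tree) 5450 5500 = true :=
  WinK.allRange_of_allRangeB (fuel := 8) (lo := 5450) (len := 50) (by decide +kernel)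

set_option maxHeartbeats 0 in
/-- Rows `[5500, 5550)` pass the check. [folklore] -/
theorem chk_5500 : WinK.allRange (NawK.checkRowF 12 4 4 12932 17090 100000 99999 100000 NawFreeZ4F12.QL NawFreeZ4F12.syms NawFreeZ4F12.tree) 5500 5550 = true :=
  WinK.allRange_of_allRangeB (fuel := 8) (lo := 5500) (len := 50) (by decide +kernel)

set_option maxHeartbeats 0 in
/-- Rows `[5550, 5600)` pass the check. [folklore] -/
theorem chk_5550 : WinK.allRange (NawK.checkRowF 12 4 4 12932 17090 100000 99999 100000 NawFreeZ4F12.QL NawFreeZ4F12.syms NawFreeZ4F12.tree) 5550 5600 = true :=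
  WinK.allRange_of_allRangeB (fuel := 8) (lo := 5550) (len := 50) (by decide +kernel)

set_option maxHeartbeats 0 in
/-- Rows `[5600, 5650)` pass the check. [folklore] -/
theorem chk_5600 : WinK.allRange (NawK.checkRowF 12 4 4 12932 17090 100000 99999 100000 NawFreeZ4F12.QL NawFreeZ4F12.syms NawFreeZ4F12.tree) 5600 5650 = true :=
  WinK.allRange_of_allRangeB (fuel := 8) (lo := 5600) (len := 50) (by decide +kernel)

set_option maxHeartbeats 0 in
/-- Rows `[5650, 5700)` pass the check. [folklore] -/
theorem chk_5650 : WinK.allRange (NawK.checkRowF 12 4 4 12932 17090 100000 99999 100000 NawFreeZ4F12.QL NawFreeZ4F12.syms NawFreeZ4F12.tree) 5650 5700 = true :=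
  WinK.allRange_of_allRangeB (fuel := 8) (lo := 5650) (len := 50) (by decide +kernel)

/-- Rows `[5400, 5700)` pass the check. [folklore] -/
theorem file_19 : WinK.allRange (NawK.checkRowF 12 4 4 12932 17090 100000 99999 100000 NawFreeZ4F12.QL NawFreeZ4F12.syms NawFreeZ4F12.tree) 5400 5700 = true := (WinK.allRange_split (WinK.allRange_split (WinK.allRange_split (WinK.allRange_split (WinK.allRange_split chk_5400 chk_5450) chk_5500) chk_5550) chk_5600) chk_5650)

end Summit.CriticalPhenomena.PercolationContinuityZ3.Theorems.Pcint.NawFreeZ4F12
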